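import Mathlib
import Literature.NumberTheory.Transcendental.KZBallPeelingAux
import HarnessLib
import HarnessLib.Audit

/-!
# SoloInformed — one-variable substitutions on `ℝ¹` as moves (generic packaging of rule 2)

Infrastructure for the chains of §6octies: a substitution `u = g(t)` of ONE variable, with `g`
given by a `ℚ`-polynomial (or rational) formula, injective and differentiable on a slab
`{x | x₀ ∈ S}` with `g(S) = T`, is an instance of KZ's move (2) on `ℝ¹`
(`soloInformed_lift_mem_changeOfVariablesRel`): the lift `x ↦ (g x₀)` (`soloInformedLift`), its
derivative `g'(x₀)·id` (`soloInformedLiftDeriv`, `det = g'(x₀)`), injectivity and image on slabs,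
and the semialgebraicity of slabs with rational endpoints. Used by
`SoloInformedDuplicationChain.lean` (the substitution `u = 4t(1−t)`); the `3`-isogeny substitution
of `SoloInformedIsogenyChain.lean` is the same pattern written out.
Residency `solo-KontsevichZagierPeriods-informed` (s22); paper §6octies.

References: M. Kontsevich, D. Zagier, *Periods* (2001), §1.2 rule (2); J. Bochnak, M. Coste,
M.-F. Roy, *Real algebraic geometry* (1998), §2.2.
-/

noncomputable section

open MeasureTheory Set Filter
namespace Summit.KontsevichZagierPeriods.KontsevichZagierPeriods.Theorems

open Literature.NumberTheory.Transcendental Literature.NumberTheory.Transcendental.KZ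
open Literature.ModelTheory.ExponentialFields

/-! ### One-variable substitutions on `ℝ¹`: a generic packaging of move (2) -/

/-- Lift of `g : ℝ → ℝ` to `ℝ¹ → ℝ¹`, `x ↦ (g x₀)`. [folklore] -/
def soloInformedLift (g : ℝ → ℝ) (x : Fin 1 → ℝ) : Fin 1 → ℝ := fun _ => g (x 0)

/-- The linear map `d · id` of `ℝ¹` (the derivative of a lift where `g' = d`). [folklore] -/
def soloInformedLiftDeriv (d : ℝ) : (Fin 1 → ℝ) →L[ℝ] (Fin 1 → ℝ) :=
  d • ContinuousLinearMap.id ℝ (Fin 1 → ℝ)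

/-- `det (d · id_{ℝ¹}) = d`. [folklore] -/
theorem soloInformed_det_liftDeriv (d : ℝ) : (soloInformedLiftDeriv d).det = d := by
  change LinearMap.det ((soloInformedLiftDeriv d : (Fin 1 → ℝ) →L[ℝ] (Fin 1 → ℝ)) :
    (Fin 1 → ℝ) →ₗ[ℝ] (Fin 1 → ℝ)) = _
  rw [soloInformedLiftDeriv, ContinuousLinearMap.toLinearMap_smul,
    ContinuousLinearMap.coe_id, LinearMap.det_smul, LinearMap.det_id, Module.finrank_fin_fun]
  simp

/-- The lift of `g` has Fréchet derivative `g'(x₀) · id` wherever `g` is differentiable.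
[folklore] -/
theorem soloInformed_hasFDerivAt_lift {g : ℝ → ℝ} {d : ℝ} {x : Fin 1 → ℝ}
    (hg : HasDerivAt g d (x 0)) :
    HasFDerivAt (soloInformedLift g) (soloInformedLiftDeriv d) x := by
  have h0 : HasFDerivAt (fun y : Fin 1 → ℝ => y 0)
      (ContinuousLinearMap.proj 0 : (Fin 1 → ℝ) →L[ℝ] ℝ) x := hasFDerivAt_apply 0 x
  have h1 : HasFDerivAt (g ∘ fun y : Fin 1 → ℝ => y 0)
      (d • (ContinuousLinearMap.proj 0 : (Fin 1 → ℝ) →L[ℝ] ℝ)) x :=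
    hg.comp_hasFDerivAt x h0
  refine hasFDerivAt_pi'' fun i => ?_
  have hL : (ContinuousLinearMap.proj i).comp (soloInformedLiftDeriv d) =
      (d • ContinuousLinearMap.proj 0 : (Fin 1 → ℝ) →L[ℝ] ℝ) := by
    refine ContinuousLinearMap.ext fun v => ?_
    fin_cases i
    simp [soloInformedLiftDeriv]
  rw [hL]
  exact h1

/-- A lift is injective on a slab where `g` is injective. [folklore] -/
theorem soloInformed_injOn_lift {g : ℝ → ℝ} {S : Set ℝ} (hg : InjOn g S) :
    InjOn (soloInformedLift g) {x : Fin 1 → ℝ | x 0 ∈ S} := by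
  intro x hx y hy h
  have h0 : g (x 0) = g (y 0) := congr_fun h 0
  have hxy := hg hx hy h0
  funext i
  fin_cases i
  exact hxy

/-- The image of a slab under a lift. [folklore] -/
theorem soloInformed_image_lift {g : ℝ → ℝ} {S T : Set ℝ} (h : g '' S = T) :
    soloInformedLift g '' {x : Fin 1 → ℝ | x 0 ∈ S} = {x : Fin 1 → ℝ | x 0 ∈ T} := by
  ext y
  constructor
  · rintro ⟨x, hx, rfl⟩
    show g (x 0) ∈ T
    rw [← h]
    exact mem_image_of_mem _ hx
  · intro hy
    obtain ⟨t, ht, hty⟩ : y 0 ∈ g '' S := by rw [h]; exact hy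
    refine ⟨fun _ => t, ht, ?_⟩
    funext i
    fin_cases i
    exact hty

/-- **Generic one-variable substitution** (move 2 on `ℝ¹`): a `ℚ`-semialgebraic `g`, injective
and differentiable on the slab `S` with `g(S) = T`, and the integrand identity
`f(x) = f'(g x) · |g'(x)|`, give `[r] − [r'] ∈ changeOfVariablesRel`.
[Kontsevich–Zagier 2001, §1.2 rule (2)] -/
theorem soloInformed_lift_mem_changeOfVariablesRel (r r' : IntegralRep 1) {g g' : ℝ → ℝ}
    {S T : Set ℝ} (hrd : r.domain = {x | x 0 ∈ S}) (hr'd : r'.domain = {x | x 0 ∈ T})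
    (hsa : IsSemialgebraicMapOn ℚ r.domain (soloInformedLift g))
    (hder : ∀ t ∈ S, HasDerivAt g (g' t) t) (hinj : InjOn g S) (himg : g '' S = T)
    (hint : ∀ x ∈ r.domain,
      r.integrand x = r'.integrand (soloInformedLift g x) * |g' (x 0)|) :
    of r - of r' ∈ changeOfVariablesRel := by
  refine ⟨1, r, r', soloInformedLift g, fun x => soloInformedLiftDeriv (g' (x 0)), hsa,
    fun x hx => ?_, ?_, ?_, fun x hx => ?_, rfl⟩
  · rw [hrd] at hx
    exact (soloInformed_hasFDerivAt_lift (hder _ hx)).hasFDerivWithinAt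
  · rw [hrd]
    exact soloInformed_injOn_lift hinj
  · rw [hrd, hr'd, soloInformed_image_lift himg]
  · rw [soloInformed_det_liftDeriv]
    exact hint x hx

/-- A slab `{x | x₀ ∈ (p, q)}` with rational endpoints is `ℚ`-semialgebraic. [BCR 1998, §2] -/
theorem soloInformed_isSemialgebraic_slab {p q : ℝ} (hp : ∃ p' : ℚ, (p' : ℝ) = p)
    (hq : ∃ q' : ℚ, (q' : ℝ) = q) : IsSemialgebraic ℚ {x : Fin 1 → ℝ | x 0 ∈ Ioo p q} := by
  obtain ⟨p', rfl⟩ := hp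
  obtain ⟨q', rfl⟩ := hq
  exact BallPeeling.isSemialgebraic_Ioo₁ p' q'

/-! ### The half-slabs `(0,½)`, `(½,1)` -/

/-- The lower half-slab is semialgebraic. [BCR 1998, §2] -/
theorem soloInformed_isSemialgebraic_lowerHalf :
    IsSemialgebraic ℚ {t : Fin 1 → ℝ | t 0 ∈ Ioo (0:ℝ) (1 / 2)} :=
  soloInformed_isSemialgebraic_slab ⟨0, by norm_num⟩ ⟨1 / 2, by norm_num⟩

/-- The upper half-slab is semialgebraic. [BCR 1998, §2] -/
theorem soloInformed_isSemialgebraic_upperHalf :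
    IsSemialgebraic ℚ {t : Fin 1 → ℝ | t 0 ∈ Ioo (1 / 2 : ℝ) 1} :=
  soloInformed_isSemialgebraic_slab ⟨1 / 2, by norm_num⟩ ⟨1, by norm_num⟩

/-- The union of the two open halves is semialgebraic. [BCR 1998, §2] -/
theorem soloInformed_isSemialgebraic_halves :
    IsSemialgebraic ℚ ({t : Fin 1 → ℝ | t 0 ∈ Ioo (0:ℝ) (1 / 2)} ∪
      {t : Fin 1 → ℝ | t 0 ∈ Ioo (1 / 2 : ℝ) 1}) :=
  soloInformed_isSemialgebraic_lowerHalf.union soloInformed_isSemialgebraic_upperHalf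

end Summit.KontsevichZagierPeriods.KontsevichZagierPeriods.Theorems

end
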